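import Literature.Probability.Percolation.KSTPeriodicWeak
import Summits.CriticalPhenomena.CardyFormulaZ2.Theorems.CardySelfRefinementCriticalPathRSWStubPhaseDiagramLandmarksA

/-!
# From the weak periodic RSW theorem to box-crossing bounds, part 2b: finite energy of the dual measure

Support file for item `stmt-CriticalPhenomena-10267` (route `CardySelfRefinement`, crux
`CriticalPathRSW`, line finite-size-envelope, stub `stub_rswOfCertificates3`).

Row finite energy of the law `μ* = M_k(ρ, c) ∘ dualConfig⁻¹` of the planar dual configuration
(faces labelled by lower-left corners, `dualConfig` of `Crossings.lean`), the last hypothesis of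
the weak periodic Russo–Seymour–Welsh theorem (Köhler-Schindler–Tassion, Duke Math. J. 172
(2023), Theorem 1 with Comment 1) for `μ*`: the dual edge `((x, 0), (x + 1, 0))` of the face row
`y = 0` is open iff the primal vertical edge based at `(x + 1, 0)` is closed, which has probability
`1/2` (axial edge) or `1 - c` (interior edge, `c` clamped to `[0, 1]`), so by positive association
a dual row segment of length `L` is open with probability `≥ p₀ ^ L` for
`p₀ ≤ min (1/2) (1 - c)` (`RswCertDual.dual_rowSegment`). On the certificate set the hard-way
certificate `M_k(𝓒(3kn₀, kn₀)) ≤ 1 - ε` bounds the clamped interior density away from one,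
`c ≤ 1 - ε / (12 k n₀)`: the `6kn₀` interior edges of the row `y = 1` across the box would be a
hard-way crossing, and they are all open with probability `≥ c^{6kn₀}` (positive association and
Bernoulli's inequality; `RswCertDual.projIcc_le_of_hard`).
-/

noncomputable section

namespace Summit.CriticalPhenomena.CardyFormulaZ2.Cruxes.CriticalPathRSW.FiniteSizeEnvelope

open Set MeasureTheory Filter Topology
open Literature.Probability.LatticeModels Literature.Probability.Percolation

namespace RswCertDual

/-! ### Row finite energy of the dual law -/

/-- The dual edge from the face `f` to the face `f + e₀` is open iff the primal vertical edge
based at `f + e₀` (which it crosses) is closed. -/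
theorem mk_mem_dualConfig_iff_notMem (ω : BondConfig (Site 2)) (f : Site 2) :
    s(f, f + Pi.single 0 1) ∈ dualConfig ω ↔
      s(f + Pi.single 0 1, f + Pi.single 0 1 + Pi.single 1 1) ∉ ω := by
  rw [dualConfig_eq, Set.mem_setOf_eq]
  have h : dualEdgeEquiv.symm s(f, f + Pi.single 0 1) =
      s(f + Pi.single 0 1, f + Pi.single 0 1 + Pi.single 1 1) := by
    rw [Equiv.symm_apply_eq, dualEdgeEquiv_apply, dualEdge_vertical, add_sub_cancel_right]
  rw [h]
  exact ⟨fun h => h.2, fun h => ⟨single_edge_mem f 0, h⟩⟩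

/-- **Row finite energy of the dual law on the face row `y = 0`**: the dual edge
`((x, 0), (x + 1, 0))` is open iff the primal vertical edge based at `(x + 1, 0)` is closed,
which has probability `1/2` (axial) or `1 - c` (interior, `c` clamped); by positive association
of the decreasing events, a dual row segment of length `L` is open with probability `≥ p₀ ^ L`
whenever `0 ≤ p₀ ≤ min (1/2) (1 - c)`. -/
theorem dual_rowSegment (k : ℕ) (ρ c : ℝ) {p₀ : ℝ} (hp0 : 0 ≤ p₀) (hp : p₀ ≤ 1 / 2)
    (hp' : p₀ ≤ 1 - Set.projIcc (0 : ℝ) 1 zero_le_one c) (a : ℤ) (L : ℕ) :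
    p₀ ^ L ≤ ((selfRefinementMeasure k ρ c).map dualConfig).real
      {ω | ∀ i : ℕ, i < L → s((![a + i, 0] : Site 2), ![a + i + 1, 0]) ∈ ω} := by
  rw [map_measureReal_apply measurable_dualConfig (KSTPeriodic.measurableSet_rowSegment a 0 L)]
  set μ := selfRefinementMeasure k ρ c with hμdef
  set E : Fin L → Set (BondConfig (Site 2)) :=
    fun i => {ω | cornerEdge ((![a + (i : ℕ) + 1, 0] : Site 2), (1 : Fin 2)) ∈ ω}ᶜ with hE
  have key : ∀ (ω : BondConfig (Site 2)) (i : ℕ), s((![a + i, 0] : Site 2), ![a + i + 1, 0]) ∈ dualConfig ω ↔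
      cornerEdge ((![a + i + 1, 0] : Site 2), (1 : Fin 2)) ∉ ω := by
    intro ω i
    have e1 : (![a + i + 1, 0] : Site 2) = ![a + i, 0] + Pi.single 0 1 := by
      ext j; fin_cases j <;> simp
    rw [e1, mk_mem_dualConfig_iff_notMem]
    rfl
  have hset : dualConfig ⁻¹' {ω : BondConfig (Site 2) | ∀ i : ℕ, i < L → s((![a + i, 0] : Site 2), ![a + i + 1, 0]) ∈ ω} =
      ⋂ i : Fin L, E i := by
    ext ω
    simp only [Set.mem_preimage, Set.mem_setOf_eq, Set.mem_iInter, hE, Set.mem_compl_iff, key]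
    exact ⟨fun h i => h i i.2, fun h i hi => h ⟨i, hi⟩⟩
  rw [hset]
  have hmeas' : ∀ i : Fin L, MeasurableSet {ω : BondConfig (Site 2) |
      cornerEdge ((![a + (i : ℕ) + 1, 0] : Site 2), (1 : Fin 2)) ∈ ω} := fun i => (measurable_set_mem _).setOf
  have hlow : ∀ i, IsLowerSet (E i) := fun i =>
    (show IsUpperSet {ω : BondConfig (Site 2) | cornerEdge ((![a + (i : ℕ) + 1, 0] : Site 2), (1 : Fin 2)) ∈ ω}
      from fun ω ω' hle hω => hle hω).compl
  have hmeas : ∀ i, MeasurableSet (E i) := fun i => (hmeas' i).compl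
  have hval : ∀ i, p₀ ≤ μ.real (E i) := by
    intro i
    simp only [hE]
    rw [probReal_compl_eq_one_sub (hmeas' i)]
    by_cases hax : IsAxialEdge k (((![a + (i : ℕ) + 1, 0] : Site 2), (1 : Fin 2)))
    · rw [selfRefinementMeasure_real_cornerEdge_mem_of_isAxialEdge k ρ c hax]
      linarith
    · rw [selfRefinementMeasure_real_cornerEdge_mem_of_not_isAxialEdge k ρ c hax]
      linarith
  calc p₀ ^ L = ∏ _i : Fin L, p₀ := by simp
    _ ≤ ∏ i : Fin L, μ.real (E i) := Finset.prod_le_prod (fun i _ => hp0) fun i _ => hval i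
    _ ≤ μ.real (⋂ i, E i) :=
        (isPositivelyAssociated_selfRefinementMeasure k ρ c).prod_real_le_iInter_lowerSet hlow hmeas

/-! ### The interior density is bounded away from `1` on the certificate set -/

/-- Bernoulli's inequality, contrapositive form: `q ^ L ≤ 1 - ε` with `q ≥ 0`, `ε > 0`, `L ≥ 1`
forces `q ≤ 1 - ε / (2L)`. -/
theorem le_one_sub_of_pow_le {q ε : ℝ} {L : ℕ} (hq : 0 ≤ q) (hε : 0 < ε) (hL : 1 ≤ L)
    (h : q ^ L ≤ 1 - ε) : q ≤ 1 - ε / (2 * L) := by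
  by_contra hlt
  rw [not_le] at hlt
  have hε1 : ε ≤ 1 := by nlinarith [pow_nonneg hq L]
  have hL' : (1 : ℝ) ≤ L := by exact_mod_cast hL
  have hL0 : (0 : ℝ) < L := by linarith
  have hdiv : ε / (2 * L) ≤ 1 / 2 := by
    rw [div_le_iff₀ (by linarith)]
    nlinarith
  have hbase : 0 ≤ 1 - ε / (2 * L) := by linarith
  have h1 : (1 - ε / (2 * L)) ^ L < q ^ L := pow_lt_pow_left₀ hlt hbase (by omega)
  have h2 : 1 - ε / 2 ≤ (1 - ε / (2 * L)) ^ L := by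
    have hb := one_add_mul_le_pow (a := -(ε / (2 * L))) (by linarith) L
    have e : 1 + (L : ℝ) * (-(ε / (2 * L))) = 1 - ε / 2 := by
      field_simp
      ring
    rw [e] at hb
    simpa [sub_eq_add_neg] using hb
  linarith

/-- **The hard-way certificate bounds the interior density away from `1`**: if
`M_k(𝓒(3kn₀, kn₀)) ≤ 1 - ε` (`k ≥ 2`, `n₀ ≥ 1`) then the clamped interior density satisfies
`c ≤ 1 - ε / (12 k n₀)`: the `6kn₀` interior edges of the row `y = 1` across the box are all
open with probability `≥ c^{6kn₀}` (positive association), and then the box is crossed. -/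
theorem projIcc_le_of_hard {k n₀ : ℕ} (hk : 2 ≤ k) (hn₀ : 1 ≤ n₀) {ε : ℝ} (hε : 0 < ε) (ρ c : ℝ)
    (h : (selfRefinementMeasure k ρ c).real (KST2023.crossing (3 * (k * n₀)) (k * n₀)) ≤ 1 - ε) :
    (Set.projIcc (0 : ℝ) 1 zero_le_one c : ℝ) ≤ 1 - ε / (2 * ((6 * (k * n₀) : ℕ) : ℝ)) := by
  set μ := selfRefinementMeasure k ρ c with hμdef
  set q : ℝ := ((Set.projIcc (0 : ℝ) 1 zero_le_one c : Set.Icc (0 : ℝ) 1) : ℝ) with hq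
  set m : ℕ := 3 * (k * n₀) with hm
  set L : ℕ := 6 * (k * n₀) with hL
  have hLm : (L : ℤ) = 2 * m := by rw [hL, hm]; push_cast; ring
  set E : Fin L → Set (BondConfig (Site 2)) :=
    fun i => {ω | cornerEdge ((![-(m : ℤ) + (i : ℕ), 1] : Site 2), (0 : Fin 2)) ∈ ω} with hE
  have hup : ∀ i, IsUpperSet (E i) := fun i ω ω' hle hω => hle hω
  have hmeas : ∀ i, MeasurableSet (E i) := fun i => (measurable_set_mem _).setOf
  have hval : ∀ i, μ.real (E i) = q := fun i =>
    selfRefinementMeasure_real_cornerEdge_mem_of_not_isAxialEdge k ρ c (LandmarksA.not_isAxialEdge_row hk _)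
  -- an open row `y = 1` across the box is a hard-way crossing
  have hincl : (⋂ i, E i) ⊆ KST2023.crossing m (k * n₀) := by
    intro ω hω
    rw [Set.mem_iInter] at hω
    have hseg : ∀ i : ℕ, i < L → s((![-(m : ℤ) + i, 1] : Site 2), ![-(m : ℤ) + i + 1, 1]) ∈ ω := by
      intro i hi
      have h1 := hω ⟨i, hi⟩
      simp only [hE, Set.mem_setOf_eq, cornerEdge] at h1
      convert h1 using 2
      ext j; fin_cases j <;> simp
    rw [← KSTPeriodic.crossing_zero_eq, KSTPeriodic.crossing]
    have hconn := KSTPeriodic.openConnIn_of_rowSegment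
      (S := KSTPeriodic.rect (-(m : ℤ) - ((0 : ℕ) : ℤ)) m (-((k * n₀ : ℕ) : ℤ) - ((0 : ℕ) : ℤ)) (k * n₀ : ℕ))
      (a := -(m : ℤ)) (y := 1) (L := L) (fun i hi => by
        simp only [KSTPeriodic.mem_rect, Matrix.cons_val_zero, Matrix.cons_val_one]
        have : (1 : ℤ) ≤ ((k * n₀ : ℕ) : ℤ) := by
          have : 1 ≤ k * n₀ := Nat.one_le_iff_ne_zero.2 (by positivity)
          exact_mod_cast this
        omega) hseg
    refine ⟨![-(m : ℤ), 1], ⟨?_, by simp⟩, ![-(m : ℤ) + L, 1], ⟨?_, ?_⟩, hconn⟩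
    · simp only [KSTPeriodic.mem_rect, Matrix.cons_val_zero, Matrix.cons_val_one]
      have : (1 : ℤ) ≤ ((k * n₀ : ℕ) : ℤ) := by
        have : 1 ≤ k * n₀ := Nat.one_le_iff_ne_zero.2 (by positivity)
        exact_mod_cast this
      omega
    · simp only [KSTPeriodic.mem_rect, Matrix.cons_val_zero, Matrix.cons_val_one]
      have : (1 : ℤ) ≤ ((k * n₀ : ℕ) : ℤ) := by
        have : 1 ≤ k * n₀ := Nat.one_le_iff_ne_zero.2 (by positivity)
        exact_mod_cast this
      omega
    · simp only [Matrix.cons_val_zero]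
      omega
  have hpow : q ^ L ≤ 1 - ε := by
    calc q ^ L = ∏ i : Fin L, μ.real (E i) := by simp [hval]
      _ ≤ μ.real (⋂ i, E i) := (isPositivelyAssociated_selfRefinementMeasure k ρ c).prod_real_le_iInter hup hmeas
      _ ≤ μ.real (KST2023.crossing m (k * n₀)) := measureReal_mono hincl
      _ ≤ 1 - ε := h
  have hL1 : 1 ≤ L := by
    rw [hL]
    have : 1 ≤ k * n₀ := Nat.one_le_iff_ne_zero.2 (by positivity)
    omega
  exact le_one_sub_of_pow_le (Set.projIcc (0 : ℝ) 1 zero_le_one c).2.1 hε hL1 hpow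

end RswCertDual

/-- **Headline of this support file** (registered sub-stub `stub_rswOfCertificates3_dualB` of
`stub_rswOfCertificates3`): the dual row finite-energy bound and the bound on the interior
density forced by the hard-way certificate. -/
theorem stub_rswOfCertificates3_dualB :
    (∀ (k : ℕ) (ρ c p₀ : ℝ), 0 ≤ p₀ → p₀ ≤ 1 / 2 → p₀ ≤ 1 - Set.projIcc (0 : ℝ) 1 zero_le_one c →
      ∀ (a : ℤ) (L : ℕ), p₀ ^ L ≤ ((selfRefinementMeasure k ρ c).map dualConfig).real
        {ω | ∀ i : ℕ, i < L → s((![a + i, 0] : Site 2), ![a + i + 1, 0]) ∈ ω}) ∧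
    (∀ (k n₀ : ℕ), 2 ≤ k → 1 ≤ n₀ → ∀ ε : ℝ, 0 < ε → ∀ ρ c : ℝ,
      (selfRefinementMeasure k ρ c).real (KST2023.crossing (3 * (k * n₀)) (k * n₀)) ≤ 1 - ε →
      (Set.projIcc (0 : ℝ) 1 zero_le_one c : ℝ) ≤ 1 - ε / (2 * ((6 * (k * n₀) : ℕ) : ℝ))) :=
  ⟨fun k ρ c _ hp0 hp hp' a L => RswCertDual.dual_rowSegment k ρ c hp0 hp hp' a L,
    fun _ _ hk hn₀ _ hε ρ c h => RswCertDual.projIcc_le_of_hard hk hn₀ hε ρ c h⟩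

end Summit.CriticalPhenomena.CardyFormulaZ2.Cruxes.CriticalPathRSW.FiniteSizeEnvelope

end
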